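import Summits.QuantumFields.BalabanUV.Beta.ValueHessianBlind
import Summits.QuantumFields.BalabanUV.Beta.GAN24.BiStencilZeroMode
import Summits.QuantumFields.BalabanUV.Beta.GAN24.TransverseDictionary

/-!
# `BalabanUV.Beta.GAN24.ValueHessianCellAdjoint` — binder row G-an2-4 ∕ (CONV-C), W-slot (α-0), ROW (C) AT LEVELS `j ≥ 1`, letter (W6)-a of the (γ) hand's memo
# `HOME/b2b-balaban-gan24-formalise-leaf-06/g52/C-LEVELS-GE1.md` §17: **CELL ADJOINTNESS OF THE VALUE HESSIAN ON PERIODIC BOUNDED DATA —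
# `Σ_{x∈box N} Σ_a (E2_j p)(a,x)·Y(a,x) = Σ_{r∈box N} Σ_b p(b,r)·(E2_j Y)(b,r)`** for `N`-periodic bounded field-leg data `p`, `Y` (every `j`, every `N ≥ 1`, every `d`, `Lc ≥ 1`;
# `(E2_j p)(a,x) := Σ'_y Σ_b E2 d Lc j x y (inl a)(inl b)·p b y`, and on the right the TRANSPOSED action `Σ'_x Σ_a E2 d Lc j x r (inl a)(inl b)·Y a x`, which is the same kernel by
# `wΦ`-reciprocity — both forms given)
# (G-an2-4 CRUX TEAM (2), seat `b2b-balaban-gan24-formalise-leaf-06` = the (γ) hand, gen 52; journal INTENT I-leaf06-g52-6)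

NOT IN PRINT; OUR BOOKKEEPING ([folklore] cell regrouping BY NAME: leaf-02's `BiStencilZeroMode.tsum_eq_sum_box_tsum`, the entry dictionary `BorderedHessian.E2_inl_inl_eq_wΦ` (translation
invariance), `decays_E2`, road-S3's reciprocity `TransverseDictionary.wΦ_symm`; 0 `def`, 0 cited fact, 0 `def … : Prop`, 0 sorry).
HONEST FRAMING (cell contract, verbatim): «discharging `BetaPertH` makes Bałaban's UV stability UNCONDITIONAL — a real constructive-QFT result; it is NOT the continuum
limit and NOT the Clay problem.»  HONEST DEPENDENCY (verbatim): «continuum YM on T⁴ ⇐ BetaPertH ∧ nine spine estimates (0/9 proved); BetaPertH ⇐ (D1) ∧ (D4) ∧ CAP+tail;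
G-an2-4 gates asym, D1 and NE2/3/4.»

WHY (memo §17 (W5)∕(W6)).  After leaf-04's cell regrouping (`CoarseBondCellPairing.sum_box_tsum_sum_mul_periodic_of_cov`) the E2E2 channel of the level-`j` direct exchange word is a CELL
pairing `⟨E2_j q_L, X̃_j (E2_j q_R)⟩_cell` of two `Lc`-periodic bounded profiles; to feed L4′ (`StepCovarianceSandwichApply.tsum_E2_G_E2_apply_of_contourSum_eq_zero`: `E2 G E2 q = wVH⁻¹·E2 q`)
the outer `E2_j` must move onto the other factor INSIDE THE CELL PAIRING — this file: periodicity of both data + translation invariance of `E2_j` + one cell decomposition each way.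
* §1 `summable_E2_row_mul_bdd` ∕ `summable_E2_col_mul_bdd` (decaying row∕column × bounded data).
* §2 **`sum_box_E2apply_mul_periodic`** — the statement in the title (transposed action on the right); **`sum_box_E2apply_mul_periodic'`** — the same with the direct action on the right
  (`wΦ_symm`).
Asserts NO value of Bałaban's tables; discharges NOTHING of (C) ∕ (C)sym ∕ (Q-L) ∕ «T2Shape» ∕ «T2Drift» ∕ (hW, hWall); NEVER «G-an2-4 closed» as (CONV-C); NOT D1, NOT
`BetaPertH`, NOT continuum, NOT Clay.  2026-08-23; no existing file touched.
-/

noncomputable section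

open Finset
open scoped BigOperators
open Literature.MathematicalPhysics.QuantumFieldTheory
open Literature.MathematicalPhysics.QuantumFieldTheory.Balaban1983to89
open Literature.MathematicalPhysics.QuantumFieldTheory.Balaban1983to89.Beta
open B12Sec2to5 (l1 l1_nonneg)
open ExpKernelCalculus (Site MKer Decays summable_exp_shift summable_exp_shift' l1_sub_symm)
open AffineAveraging (box toSite)
open KernelSpecInstance (wΦ)
open OneStepResolventKernel (Fib)
open BalabanStepJetsSucc (E2 decays_E2)
open Summit.QuantumFields.BalabanUV.Beta.BorderedHessian (E2_inl_inl_eq_wΦ)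
open Summit.QuantumFields.BalabanUV.Beta.GAN24.BiStencilZeroMode (tsum_eq_sum_box_tsum)
open Summit.QuantumFields.BalabanUV.Beta.GAN24.TransverseDictionary (wΦ_symm)

namespace Summit.QuantumFields.BalabanUV.Beta.GAN24.ValueHessianCellAdjoint

variable {d : ℕ} {Lc : ℕ} [NeZero Lc]

/-! ## §1 Summability -/

/-- [folklore] A row of the value Hessian against bounded field-leg data is summable. -/
theorem summable_E2_row_mul_bdd (j : ℕ) {p : Fin (d + 1) → Site (d + 1) → ℝ} {B : ℝ} (hpB : ∀ b y, |p b y| ≤ B) (x : Site (d + 1)) (a : Fin (d + 1)) :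
    Summable fun y => ∑ b : Fin (d + 1), E2 d Lc j x y (Sum.inl a) (Sum.inl b) * p b y := by
  obtain ⟨δ, C, hδ, hC, hE⟩ := decays_E2 (d := d) (Lc := Lc) j
  have hB : 0 ≤ B := (abs_nonneg _).trans (hpB 0 0)
  refine Summable.of_norm_bounded ((summable_exp_shift hδ x).mul_left (((d : ℝ) + 1) * (C * B))) fun y => ?_
  rw [Real.norm_eq_abs]
  refine (Finset.abs_sum_le_sum_abs _ _).trans ?_
  have hterm : ∀ b : Fin (d + 1), |E2 d Lc j x y (Sum.inl a) (Sum.inl b) * p b y| ≤ C * B * Real.exp (-δ * l1 (x - y)) := by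
    intro b
    rw [abs_mul]
    calc |E2 d Lc j x y (Sum.inl a) (Sum.inl b)| * |p b y| ≤ (C * Real.exp (-δ * l1 (x - y))) * B :=
          mul_le_mul (hE x y _ _) (hpB b y) (abs_nonneg _) (by positivity)
      _ = _ := by ring
  refine (Finset.sum_le_sum fun b _ => hterm b).trans (le_of_eq ?_)
  rw [Finset.sum_const, Finset.card_univ, Fintype.card_fin, nsmul_eq_mul]
  push_cast
  ring

/-- [folklore] A column of the value Hessian against bounded field-leg data is summable. -/
theorem summable_E2_col_mul_bdd (j : ℕ) {Y : Fin (d + 1) → Site (d + 1) → ℝ} {B : ℝ} (hYB : ∀ a x, |Y a x| ≤ B) (y : Site (d + 1)) (b : Fin (d + 1)) :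
    Summable fun x => ∑ a : Fin (d + 1), E2 d Lc j x y (Sum.inl a) (Sum.inl b) * Y a x := by
  obtain ⟨δ, C, hδ, hC, hE⟩ := decays_E2 (d := d) (Lc := Lc) j
  have hB : 0 ≤ B := (abs_nonneg _).trans (hYB 0 0)
  refine Summable.of_norm_bounded ((summable_exp_shift' hδ y).mul_left (((d : ℝ) + 1) * (C * B))) fun x => ?_
  rw [Real.norm_eq_abs]
  refine (Finset.abs_sum_le_sum_abs _ _).trans ?_
  have hterm : ∀ a : Fin (d + 1), |E2 d Lc j x y (Sum.inl a) (Sum.inl b) * Y a x| ≤ C * B * Real.exp (-δ * l1 (x - y)) := by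
    intro a
    rw [abs_mul]
    calc |E2 d Lc j x y (Sum.inl a) (Sum.inl b)| * |Y a x| ≤ (C * Real.exp (-δ * l1 (x - y))) * B :=
          mul_le_mul (hE x y _ _) (hYB a x) (abs_nonneg _) (by positivity)
      _ = _ := by ring
  refine (Finset.sum_le_sum fun a _ => hterm a).trans (le_of_eq ?_)
  rw [Finset.sum_const, Finset.card_univ, Fintype.card_fin, nsmul_eq_mul]
  push_cast
  ring

/-! ## §2 Cell adjointness -/

/-- [folklore] Translation invariance of the value Hessian's field–field block. -/
theorem E2_inl_inl_translate (j : ℕ) (x y t : Site (d + 1)) (a b : Fin (d + 1)) :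
    E2 d Lc j (x + t) (y + t) (Sum.inl a) (Sum.inl b) = E2 d Lc j x y (Sum.inl a) (Sum.inl b) := by
  rw [E2_inl_inl_eq_wΦ, E2_inl_inl_eq_wΦ]
  congr 1
  abel

/-- [folklore] **CELL ADJOINTNESS OF THE VALUE HESSIAN ON PERIODIC BOUNDED DATA** (transposed action on the right): for `N`-periodic bounded field-leg data `p`, `Y`,
`Σ_{x∈box N} Σ_a (Σ'_y Σ_b E2_j(x,y)_{ab}·p b y)·Y a x = Σ_{r∈box N} Σ_b p b r·(Σ'_x Σ_a E2_j(x,r)_{ab}·Y a x)`. -/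
theorem sum_box_E2apply_mul_periodic (j : ℕ) {N : ℕ} [NeZero N] {p Y : Fin (d + 1) → Site (d + 1) → ℝ} {B : ℝ}
    (hp : ∀ b y t, p b (y + (N : ℤ) • t) = p b y) (hY : ∀ a x t, Y a (x + (N : ℤ) • t) = Y a x) (hpB : ∀ b y, |p b y| ≤ B) (hYB : ∀ a x, |Y a x| ≤ B) :
    ∑ x ∈ box (d + 1) N, ∑ a : Fin (d + 1), (∑' y, ∑ b : Fin (d + 1), E2 d Lc j (toSite x) y (Sum.inl a) (Sum.inl b) * p b y) * Y a (toSite x) =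
      ∑ r ∈ box (d + 1) N, ∑ b : Fin (d + 1), p b (toSite r) * ∑' x, ∑ a : Fin (d + 1), E2 d Lc j x (toSite r) (Sum.inl a) (Sum.inl b) * Y a x := by
  obtain ⟨δ, C, hδ, hC, hE⟩ := decays_E2 (d := d) (Lc := Lc) j
  have hB : 0 ≤ B := (abs_nonneg _).trans (hpB 0 0)
  -- the translated column series `T x a r b := Σ'_t E2 (x, N•t + r)_{ab}` and its summability
  have hsT : ∀ (x r : Site (d + 1)) (a b : Fin (d + 1)) (c : ℝ),
      Summable fun t : Site (d + 1) => E2 d Lc j x ((N : ℤ) • t + r) (Sum.inl a) (Sum.inl b) * c := by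
    intro x r a b c
    refine Summable.of_norm_bounded (((summable_exp_shift hδ x).comp_injective (InterLevelTransport.sublattice_injective N r)).mul_left (C * |c|))
      fun t => ?_
    rw [Real.norm_eq_abs, abs_mul, Function.comp_apply]
    calc |E2 d Lc j x ((N : ℤ) • t + r) (Sum.inl a) (Sum.inl b)| * |c| ≤ (C * Real.exp (-δ * l1 (x - ((N : ℤ) • t + r)))) * |c| :=
          mul_le_mul_of_nonneg_right (hE _ _ _ _) (abs_nonneg c)
      _ = _ := by ring
  -- (1) cell-decompose the inner `y`-series of the left side; the periodicity of `p` collects `p b r`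
  have hL : ∀ (x : Fin (d + 1) → ℕ) (a : Fin (d + 1)),
      (∑' y, ∑ b : Fin (d + 1), E2 d Lc j (toSite x) y (Sum.inl a) (Sum.inl b) * p b y) =
        ∑ r ∈ box (d + 1) N, ∑ b : Fin (d + 1), p b (toSite r) *
          ∑' t : Site (d + 1), E2 d Lc j (toSite x) ((N : ℤ) • t + toSite r) (Sum.inl a) (Sum.inl b) := by
    intro x a
    rw [tsum_eq_sum_box_tsum (N := N) (summable_E2_row_mul_bdd (Lc := Lc) j hpB (toSite x) a)]
    refine Finset.sum_congr rfl fun r _ => ?_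
    have hp' : ∀ (b : Fin (d + 1)) (t : Site (d + 1)), p b ((N : ℤ) • t + toSite r) = p b (toSite r) := fun b t => by
      rw [add_comm]; exact hp b (toSite r) t
    calc (∑' t : Site (d + 1), ∑ b : Fin (d + 1), E2 d Lc j (toSite x) ((N : ℤ) • t + toSite r) (Sum.inl a) (Sum.inl b) * p b ((N : ℤ) • t + toSite r))
        = ∑' t : Site (d + 1), ∑ b : Fin (d + 1), E2 d Lc j (toSite x) ((N : ℤ) • t + toSite r) (Sum.inl a) (Sum.inl b) * p b (toSite r) :=
          tsum_congr fun t => Finset.sum_congr rfl fun b _ => by rw [hp']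
      _ = ∑ b : Fin (d + 1), ∑' t : Site (d + 1), E2 d Lc j (toSite x) ((N : ℤ) • t + toSite r) (Sum.inl a) (Sum.inl b) * p b (toSite r) :=
          Summable.tsum_finsetSum fun b _ => hsT _ _ a b _
      _ = _ := Finset.sum_congr rfl fun b _ => by rw [tsum_mul_right, mul_comm]
  -- (2) the `(x ∈ box, t)` double series against `Y` is ONE lattice series (periodicity of `Y`, translation invariance of `E2`)
  have hR : ∀ (r : Fin (d + 1) → ℕ) (b : Fin (d + 1)),
      (∑ x ∈ box (d + 1) N, ∑ a : Fin (d + 1), (∑' t : Site (d + 1), E2 d Lc j (toSite x) ((N : ℤ) • t + toSite r) (Sum.inl a) (Sum.inl b)) * Y a (toSite x)) =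
        ∑' x, ∑ a : Fin (d + 1), E2 d Lc j x (toSite r) (Sum.inl a) (Sum.inl b) * Y a x := by
    intro r b
    rw [tsum_eq_sum_box_tsum (N := N) (summable_E2_col_mul_bdd (Lc := Lc) j hYB (toSite r) b)]
    refine Finset.sum_congr rfl fun x _ => ?_
    calc (∑ a : Fin (d + 1), (∑' t : Site (d + 1), E2 d Lc j (toSite x) ((N : ℤ) • t + toSite r) (Sum.inl a) (Sum.inl b)) * Y a (toSite x))
        = ∑ a : Fin (d + 1), ∑' t : Site (d + 1), E2 d Lc j (toSite x) ((N : ℤ) • t + toSite r) (Sum.inl a) (Sum.inl b) * Y a (toSite x) :=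
          Finset.sum_congr rfl fun a _ => tsum_mul_right.symm
      _ = ∑' t : Site (d + 1), ∑ a : Fin (d + 1), E2 d Lc j (toSite x) ((N : ℤ) • t + toSite r) (Sum.inl a) (Sum.inl b) * Y a (toSite x) :=
          (Summable.tsum_finsetSum fun a _ => hsT _ _ a b _).symm
      _ = ∑' t : Site (d + 1), ∑ a : Fin (d + 1), E2 d Lc j (toSite x) ((N : ℤ) • (-t) + toSite r) (Sum.inl a) (Sum.inl b) * Y a (toSite x) :=
          ((Equiv.neg (Site (d + 1))).tsum_eq (fun t : Site (d + 1) => ∑ a : Fin (d + 1),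
            E2 d Lc j (toSite x) ((N : ℤ) • t + toSite r) (Sum.inl a) (Sum.inl b) * Y a (toSite x))).symm
      _ = ∑' t : Site (d + 1), ∑ a : Fin (d + 1), E2 d Lc j ((N : ℤ) • t + toSite x) (toSite r) (Sum.inl a) (Sum.inl b) * Y a ((N : ℤ) • t + toSite x) := by
          refine tsum_congr fun t => Finset.sum_congr rfl fun a _ => ?_
          have e1 : E2 d Lc j (toSite x) ((N : ℤ) • (-t) + toSite r) (Sum.inl a) (Sum.inl b) =
              E2 d Lc j ((N : ℤ) • t + toSite x) (toSite r) (Sum.inl a) (Sum.inl b) := by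
            rw [← E2_inl_inl_translate (Lc := Lc) j (toSite x) ((N : ℤ) • (-t) + toSite r) ((N : ℤ) • t) a b]
            congr 1
            · abel
            · rw [smul_neg]; abel
          have e2 : Y a (toSite x) = Y a ((N : ℤ) • t + toSite x) := by
            rw [show (N : ℤ) • t + toSite x = toSite x + (N : ℤ) • t by abel, hY]
          rw [e1, e2]
  -- (3) finite bookkeeping
  simp_rw [hL]
  calc ∑ x ∈ box (d + 1) N, ∑ a : Fin (d + 1), (∑ r ∈ box (d + 1) N, ∑ b : Fin (d + 1), p b (toSite r) *
          ∑' t : Site (d + 1), E2 d Lc j (toSite x) ((N : ℤ) • t + toSite r) (Sum.inl a) (Sum.inl b)) * Y a (toSite x)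
      = ∑ x ∈ box (d + 1) N, ∑ a : Fin (d + 1), ∑ r ∈ box (d + 1) N, ∑ b : Fin (d + 1), p b (toSite r) *
          ((∑' t : Site (d + 1), E2 d Lc j (toSite x) ((N : ℤ) • t + toSite r) (Sum.inl a) (Sum.inl b)) * Y a (toSite x)) := by
        refine Finset.sum_congr rfl fun x _ => Finset.sum_congr rfl fun a _ => ?_
        rw [Finset.sum_mul]
        refine Finset.sum_congr rfl fun r _ => ?_
        rw [Finset.sum_mul]
        exact Finset.sum_congr rfl fun b _ => by ring
    _ = ∑ x ∈ box (d + 1) N, ∑ r ∈ box (d + 1) N, ∑ a : Fin (d + 1), ∑ b : Fin (d + 1), p b (toSite r) *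
          ((∑' t : Site (d + 1), E2 d Lc j (toSite x) ((N : ℤ) • t + toSite r) (Sum.inl a) (Sum.inl b)) * Y a (toSite x)) :=
        Finset.sum_congr rfl fun x _ => Finset.sum_comm
    _ = ∑ r ∈ box (d + 1) N, ∑ x ∈ box (d + 1) N, ∑ a : Fin (d + 1), ∑ b : Fin (d + 1), p b (toSite r) *
          ((∑' t : Site (d + 1), E2 d Lc j (toSite x) ((N : ℤ) • t + toSite r) (Sum.inl a) (Sum.inl b)) * Y a (toSite x)) := Finset.sum_comm
    _ = ∑ r ∈ box (d + 1) N, ∑ x ∈ box (d + 1) N, ∑ b : Fin (d + 1), ∑ a : Fin (d + 1), p b (toSite r) *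
          ((∑' t : Site (d + 1), E2 d Lc j (toSite x) ((N : ℤ) • t + toSite r) (Sum.inl a) (Sum.inl b)) * Y a (toSite x)) :=
        Finset.sum_congr rfl fun r _ => Finset.sum_congr rfl fun x _ => Finset.sum_comm
    _ = ∑ r ∈ box (d + 1) N, ∑ b : Fin (d + 1), ∑ x ∈ box (d + 1) N, ∑ a : Fin (d + 1), p b (toSite r) *
          ((∑' t : Site (d + 1), E2 d Lc j (toSite x) ((N : ℤ) • t + toSite r) (Sum.inl a) (Sum.inl b)) * Y a (toSite x)) :=
        Finset.sum_congr rfl fun r _ => Finset.sum_comm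
    _ = _ := by
        refine Finset.sum_congr rfl fun r _ => Finset.sum_congr rfl fun b _ => ?_
        rw [← hR r b, Finset.mul_sum]
        exact Finset.sum_congr rfl fun x _ => by rw [Finset.mul_sum]

/-- [folklore] **… with the direct action on the right** (`wΦ`-reciprocity): `Σ_{x∈box} Σ_a (E2_j p)(a,x)·Y a x = Σ_{r∈box} Σ_b p b r·(Σ'_x Σ_a E2_j(r,x)_{ba}·Y a x)`. -/
theorem sum_box_E2apply_mul_periodic' (j : ℕ) {N : ℕ} [NeZero N] {p Y : Fin (d + 1) → Site (d + 1) → ℝ} {B : ℝ}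
    (hp : ∀ b y t, p b (y + (N : ℤ) • t) = p b y) (hY : ∀ a x t, Y a (x + (N : ℤ) • t) = Y a x) (hpB : ∀ b y, |p b y| ≤ B) (hYB : ∀ a x, |Y a x| ≤ B) :
    ∑ x ∈ box (d + 1) N, ∑ a : Fin (d + 1), (∑' y, ∑ b : Fin (d + 1), E2 d Lc j (toSite x) y (Sum.inl a) (Sum.inl b) * p b y) * Y a (toSite x) =
      ∑ r ∈ box (d + 1) N, ∑ b : Fin (d + 1), p b (toSite r) * ∑' x, ∑ a : Fin (d + 1), E2 d Lc j (toSite r) x (Sum.inl b) (Sum.inl a) * Y a x := by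
  rw [sum_box_E2apply_mul_periodic (Lc := Lc) j hp hY hpB hYB]
  refine Finset.sum_congr rfl fun r _ => Finset.sum_congr rfl fun b _ => ?_
  congr 1
  refine tsum_congr fun x => Finset.sum_congr rfl fun a _ => ?_
  rw [E2_inl_inl_eq_wΦ, E2_inl_inl_eq_wΦ, wΦ_symm]
  congr 2
  abel

end Summit.QuantumFields.BalabanUV.Beta.GAN24.ValueHessianCellAdjoint

end
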